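import Summits.AtomisticToContinuum.Crystallization.Theorems.ExcessDecayLiouvilleLinearLevels

/-!
# Route `ExcessDecayLiouville`: one Caccioppoli level in MASS FORM (linear levels, III)

Linear half of the harmonic-replacement architecture for item `ExcessDecay` (stmt-AtomisticToContinuum-9334).
With the local mass `M(f; X) = Σ'_p ‖f p‖² 𝟙[dist p c₀ ≤ X]`, the weighted far mass
`J_Y(f) = Σ'_q ‖f q‖² (max(dist q c₀, Y))⁻⁸` and the lattice difference `Δ_τ f = f(· + Aτ) − f`:

* `mass_mono`, `normA_gen_le`, `dom_gen`, `gen_mem` : monotonicity of the local mass; the three forward generators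
  `u₁, u₂, w₃` have `‖A e‖ ≤ 2` and domination constant `4`;
* `level_rhs_le`, `diff_sum_le`, `mass_diff_le` : one level in mass form (weight `μ = R³`): for `f` with zero
  operator rows on `dist · c₀ ≤ ρ_f`, `1 ≤ R`, `2R + 2 ≤ ρ_f`, `0 < Y ≤ 2R + 2`,
  `κ M(Δ_τ f; R) ≤ M_τ [ (C_a/R²) M(f; 4R+4) + C_J J_Y(f) ]`;
* `mass_diff_le_work` : the same with operator rows `Gf` (work term `Σ'η²⟪Gf,f⟫` kept);
* `cross_sum_le` : the same for the cross-sublattice difference (constant `1`);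
* `farWeight_shift_le`, `farMass_translate_le`, `farMass_diff_le` : `J_Y(f(· + Aτ)) ≤ 2 J_Y(f)`,
  `J_Y(Δ_τ f) ≤ 6 J_Y(f)` (`Y ≥ 25`, `‖Aτ‖ ≤ 2`).

All `[folklore]`; helper lemmas, nothing here closes an item.
-/

noncomputable section

namespace Summit.AtomisticToContinuum.Crystallization.Theorems.ExcessDecayLiouville

open scoped BigOperators Topology InnerProductSpace RealInnerProductSpace Classical
open Literature.MathematicalPhysics.StatisticalMechanics
open Summit.AtomisticToContinuum.Crystallization.Theorems.PhononStabilityNegative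

-- Local notation: the force-constant map `K(e)w = h(|e|²)w + 2⟪e,w⟫h′(|e|²)e`.
local notation3 "𝕂[" e "] " w:max =>
  (-((‖e‖ ^ 2)⁻¹) ^ 7 + ((‖e‖ ^ 2)⁻¹) ^ 4) • w + (2 * ⟪e, w⟫ * (7 * ((‖e‖ ^ 2)⁻¹) ^ 8 - 4 * ((‖e‖ ^ 2)⁻¹) ^ 5)) • e
set_option quotPrecheck false in
local notation "𝟙ᵇ[" x ", " c ", " R "]" => (if dist (x : EuclideanSpace ℝ (Fin 3)) c ≤ R then (1 : ℝ) else 0)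
set_option quotPrecheck false in
local notation "𝔣[" ρ ", " p ", " q "]" =>
  (if ρ < dist (p : EuclideanSpace ℝ (Fin 3)) q then (dist (p : EuclideanSpace ℝ (Fin 3)) q)⁻¹ ^ 8 else (0 : ℝ))
-- the three forward generators of `Λ₀`
local notation "𝐮₁" => (triangularVec₁ 1 : EuclideanSpace ℝ (Fin 3))
local notation "𝐮₂" => (triangularVec₂ 1 : EuclideanSpace ℝ (Fin 3))
local notation "𝐰₃" => (layerNormal (2 * Real.sqrt (2 / 3)) : EuclideanSpace ℝ (Fin 3))
-- the constants of one level in mass form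
local notation "Cₐ" => (19 * (1024 / ((23 / 25 : ℝ) ^ 3 * (23 / 25 : ℝ) ^ 3)) + 38 * (1024 / (23 / 25 : ℝ) ^ 3))
local notation "Cⱼ" => (9961472 : ℝ)

section

variable {t : Fin 2 → (EuclideanSpace ℝ (Fin 3))} {A : (EuclideanSpace ℝ (Fin 3)) →L[ℝ] (EuclideanSpace ℝ (Fin 3))}
  {c₀ : EuclideanSpace ℝ (Fin 3)} {κ : ℝ}

set_option quotPrecheck false in
-- Local notation: the operator row `(L v)(p)`.
local notation "𝕃" v:max " @ " p:max =>
  tsum (fun q : Sites₀ t A => (if ((p : Sites₀ t A) : EuclideanSpace ℝ (Fin 3)) ≠ q then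
    𝕂[((p : Sites₀ t A) : EuclideanSpace ℝ (Fin 3)) - q] (v ((p : Sites₀ t A) : EuclideanSpace ℝ (Fin 3)) - v q) else 0))
set_option quotPrecheck false in
-- local mass on the ball of radius `X` about the section centre `c₀`
local notation "𝐌[" f ", " X "]" =>
  tsum (fun p : Sites₀ t A => ‖f (p : EuclideanSpace ℝ (Fin 3))‖ ^ 2 * 𝟙ᵇ[p, c₀, X])
set_option quotPrecheck false in
-- weighted far mass with floor `Y` about `c₀`
local notation "𝐉[" f ", " Y "]" =>
  tsum (fun q : Sites₀ t A => ‖f (q : EuclideanSpace ℝ (Fin 3))‖ ^ 2 * (max (dist (q : EuclideanSpace ℝ (Fin 3)) c₀) Y)⁻¹ ^ 8)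
set_option quotPrecheck false in
-- lattice difference
local notation "Δ[" τ "] " f:max => (fun x : EuclideanSpace ℝ (Fin 3) => f (x + A τ) - f x)
set_option quotPrecheck false in
-- the level constant `L = (4Cₐ + 24Cⱼ)/κ + 1`
local notation "𝐋" => ((4 * Cₐ + 24 * Cⱼ) / κ + 1)

/-! ## Monotonicity, generators, domination -/

/-- The local mass is monotone in the radius. [folklore] -/
theorem mass_mono (hA : Adm₀ A) (hI : Inner₀ t A) (f : (EuclideanSpace ℝ (Fin 3)) → (EuclideanSpace ℝ (Fin 3)))
    {X X' : ℝ} (hX : X ≤ X') : 𝐌[f, X] ≤ 𝐌[f, X'] := by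
  refine (summable_normSq_indicator hA hI f c₀ X).tsum_le_tsum (fun p => ?_) (summable_normSq_indicator hA hI f c₀ X')
  have h0 : 0 ≤ ‖f p‖ ^ 2 := sq_nonneg _
  by_cases hx : dist (p : EuclideanSpace ℝ (Fin 3)) c₀ ≤ X
  · rw [if_pos hx, if_pos (hx.trans hX)]
  · rw [if_neg hx, mul_zero]; split_ifs <;> positivity

/-- The local mass is nonnegative. [folklore] -/
theorem mass_nonneg (f : (EuclideanSpace ℝ (Fin 3)) → (EuclideanSpace ℝ (Fin 3))) (X : ℝ) : 0 ≤ 𝐌[f, X] :=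
  tsum_nonneg fun p => by split_ifs <;> positivity

/-- The weighted far mass is nonnegative. [folklore] -/
theorem farMass_nonneg (f : (EuclideanSpace ℝ (Fin 3)) → (EuclideanSpace ℝ (Fin 3))) (Y : ℝ) (hY : 0 < Y) :
    0 ≤ 𝐉[f, Y] :=
  tsum_nonneg fun q => by
    have : 0 < max (dist (q : EuclideanSpace ℝ (Fin 3)) c₀) Y := lt_max_of_lt_right hY
    positivity

/-- The images of the three forward generators have norm at most `2`. [folklore] -/
theorem normA_gen_le (hA : Adm₀ A) : ‖A 𝐮₁‖ ≤ 2 ∧ ‖A 𝐮₂‖ ≤ 2 ∧ ‖A 𝐰₃‖ ≤ 2 := by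
  have hn := norm_le_of_adm₀ hA
  obtain ⟨h1, h2, h3⟩ := norm_generators_le
  have key : ∀ v : EuclideanSpace ℝ (Fin 3), ‖v‖ ≤ 2 → ‖A v‖ ≤ 2 := fun v hv =>
    calc ‖A v‖ ≤ ‖A‖ * ‖v‖ := A.le_opNorm v
      _ ≤ (199 / 200) * 2 := mul_le_mul hn hv (norm_nonneg _) (by norm_num)
      _ ≤ 2 := by norm_num
  exact ⟨key _ h1, key _ h2, key _ h3⟩

/-- **Domination constant `4` for the three forward generators.** [folklore] -/
theorem dom_gen (hA : Adm₀ A) (hI : Inner₀ t A) {e : EuclideanSpace ℝ (Fin 3)} (he : e = 𝐮₁ ∨ e = 𝐮₂ ∨ e = 𝐰₃)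
    (v : (EuclideanSpace ℝ (Fin 3)) → (EuclideanSpace ℝ (Fin 3))) (hv : (Function.support v).Finite) :
    ∑' p : Sites₀ t A, ‖v p - v ((p : (EuclideanSpace ℝ (Fin 3))) + A e)‖ ^ 2 ≤ 4 * nnForm t A v := by
  have h0 := nnForm_nonneg t A v
  obtain ⟨hu1, hu2⟩ := norm_apply_triangularVec_le hA
  rcases he with rfl | rfl | rfl
  · exact (tsum_norm_sub_translate_sq_le_nnForm hA hI hv triangularVec₁_mem_Λ₀ hu1).trans (by linarith)
  · exact (tsum_norm_sub_translate_sq_le_nnForm hA hI hv triangularVec₂_mem_Λ₀ hu2).trans (by linarith)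
  · exact tsum_norm_sub_vertical_sq_le_nnForm hA hI hv

/-- The three forward generators lie in `Λ₀` and have `‖A e‖ ≤ 2`. [folklore] -/
theorem gen_mem (hA : Adm₀ A) {e : EuclideanSpace ℝ (Fin 3)} (he : e = 𝐮₁ ∨ e = 𝐮₂ ∨ e = 𝐰₃) :
    e ∈ Λ₀ ∧ ‖A e‖ ≤ 2 := by
  obtain ⟨h1, h2, h3⟩ := normA_gen_le hA
  rcases he with rfl | rfl | rfl
  exacts [⟨triangularVec₁_mem_Λ₀, h1⟩, ⟨triangularVec₂_mem_Λ₀, h2⟩, ⟨layerNormal_two_mem_Λ₀, h3⟩]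

/-! ## One level in mass form -/

/-- Arithmetic of one level with the weight `μ = R³`: the three right-hand terms of `level_estimate` plus the
tail split are bounded by `(Cₐ/R²) M(f; 4R+4) + Cⱼ J_Y(f)`. [folklore] -/
theorem level_rhs_le (hA : Adm₀ A) (hI : Inner₀ t A) {f : (EuclideanSpace ℝ (Fin 3)) → (EuclideanSpace ℝ (Fin 3))}
    (hf : (Function.support f).Finite) {R Y : ℝ} (hR : 1 ≤ R) (hY : 0 < Y) (hYR : Y ≤ 2 * R + 2) :
    19 * (1024 / ((23 / 25 : ℝ) ^ 3 * (23 / 25 : ℝ) ^ 3)) / R ^ 2 * 𝐌[f, 2 * R + 2 + R] +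
      19 * R ^ 3 * (1024 / ((23 / 25 : ℝ) ^ 3 * R ^ 5)) * 𝐌[f, 2 * R + 2] +
      19 * (R ^ 3)⁻¹ * (∑' p : Sites₀ t A, ∑' q : Sites₀ t A, (if (p : (EuclideanSpace ℝ (Fin 3))) ≠ q then
        𝔣[R, p, q] * 𝟙ᵇ[p, c₀, 2 * R + 2] * ‖f q‖ ^ 2 else 0)) ≤
      Cₐ / R ^ 2 * 𝐌[f, 4 * R + 4] + Cⱼ * 𝐉[f, Y] := by
  have hR0 : 0 < R := by linarith
  have hT := tail_le_local_add_far hA hI hf c₀ (R' := 2 * R + 2) (ρ' := R) (Y := Y) (by linarith) (by linarith) hY hYR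
  have hM1 : 𝐌[f, 2 * R + 2 + R] ≤ 𝐌[f, 4 * R + 4] := mass_mono hA hI f (by linarith)
  have hM2 : 𝐌[f, 2 * R + 2] ≤ 𝐌[f, 4 * R + 4] := mass_mono hA hI f (by linarith)
  have hM3 : 𝐌[f, 2 * (2 * R + 2)] ≤ 𝐌[f, 4 * R + 4] := mass_mono hA hI f (by linarith)
  have hM0 : 0 ≤ 𝐌[f, 4 * R + 4] := mass_nonneg f _
  have hJ0 : 0 ≤ 𝐉[f, Y] := farMass_nonneg f Y hY
  set M4 := 𝐌[f, 4 * R + 4] with hM4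
  set J := 𝐉[f, Y] with hJdef
  set C6 : ℝ := 1024 / ((23 / 25 : ℝ) ^ 3 * (23 / 25 : ℝ) ^ 3) with hC6
  set C3 : ℝ := 1024 / (23 / 25 : ℝ) ^ 3 with hC3
  have hC60 : 0 ≤ C6 := by rw [hC6]; positivity
  have hC30 : 0 ≤ C3 := by rw [hC3]; positivity
  -- the three coefficients
  have e2 : 19 * R ^ 3 * (1024 / ((23 / 25 : ℝ) ^ 3 * R ^ 5)) = 19 * C3 / R ^ 2 := by
    rw [hC3]; field_simp
  have e3 : 1024 / ((23 / 25 : ℝ) ^ 3 * R ^ 5) = C3 / R ^ 5 := by rw [hC3]; field_simp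
  have hR2 : 0 < R ^ 2 := by positivity
  have hinv8 : (R ^ 3)⁻¹ * (C3 / R ^ 5) ≤ C3 / R ^ 2 := by
    rw [div_eq_mul_inv, div_eq_mul_inv, ← mul_assoc, mul_comm ((R ^ 3)⁻¹), mul_assoc, ← mul_inv]
    refine mul_le_mul_of_nonneg_left ((inv_le_inv₀ (by positivity) hR2).2 ?_) hC30
    have : (1 : ℝ) ≤ R ^ 6 := one_le_pow₀ hR
    nlinarith
  have hcube : (2 * R + 2) ^ 3 ≤ 64 * R ^ 3 := by
    have : 2 * R + 2 ≤ 4 * R := by linarith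
    calc (2 * R + 2) ^ 3 ≤ (4 * R) ^ 3 := pow_le_pow_left₀ (by linarith) this 3
      _ = 64 * R ^ 3 := by ring
  have hinvJ : (R ^ 3)⁻¹ * (8192 * (2 * R + 2) ^ 3) ≤ 8192 * 64 := by
    rw [inv_mul_le_iff₀ (by positivity)]
    nlinarith
  -- assemble
  have t1 : 19 * C6 / R ^ 2 * 𝐌[f, 2 * R + 2 + R] ≤ 19 * C6 / R ^ 2 * M4 :=
    mul_le_mul_of_nonneg_left hM1 (by positivity)
  have t2 : 19 * R ^ 3 * (1024 / ((23 / 25 : ℝ) ^ 3 * R ^ 5)) * 𝐌[f, 2 * R + 2] ≤ 19 * C3 / R ^ 2 * M4 := by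
    rw [e2]; exact mul_le_mul_of_nonneg_left hM2 (by positivity)
  have t3 : 19 * (R ^ 3)⁻¹ * (∑' p : Sites₀ t A, ∑' q : Sites₀ t A, (if (p : (EuclideanSpace ℝ (Fin 3))) ≠ q then
        𝔣[R, p, q] * 𝟙ᵇ[p, c₀, 2 * R + 2] * ‖f q‖ ^ 2 else 0)) ≤ 19 * C3 / R ^ 2 * M4 + 19 * (8192 * 64) * J := by
    rw [e3] at hT
    calc 19 * (R ^ 3)⁻¹ * (∑' p : Sites₀ t A, ∑' q : Sites₀ t A, (if (p : (EuclideanSpace ℝ (Fin 3))) ≠ q then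
          𝔣[R, p, q] * 𝟙ᵇ[p, c₀, 2 * R + 2] * ‖f q‖ ^ 2 else 0))
        ≤ 19 * (R ^ 3)⁻¹ * (C3 / R ^ 5 * 𝐌[f, 2 * (2 * R + 2)] + 8192 * (2 * R + 2) ^ 3 * J) :=
          mul_le_mul_of_nonneg_left hT (by positivity)
      _ ≤ 19 * (R ^ 3)⁻¹ * (C3 / R ^ 5 * M4 + 8192 * (2 * R + 2) ^ 3 * J) := by
          gcongr
      _ = 19 * ((R ^ 3)⁻¹ * (C3 / R ^ 5)) * M4 + 19 * ((R ^ 3)⁻¹ * (8192 * (2 * R + 2) ^ 3)) * J := by ring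
      _ ≤ 19 * (C3 / R ^ 2) * M4 + 19 * (8192 * 64) * J := by
          gcongr
      _ = 19 * C3 / R ^ 2 * M4 + 19 * (8192 * 64) * J := by ring
  have hsum : 19 * C6 / R ^ 2 * M4 + 19 * C3 / R ^ 2 * M4 + (19 * C3 / R ^ 2 * M4 + 19 * (8192 * 64) * J) =
      Cₐ / R ^ 2 * M4 + Cⱼ * J := by
    rw [hC6, hC3]; ring
  linarith

/-- **One level in mass form, on an arbitrary finite set** `F ⊆ S ∩ B_R(c₀)`: for `f` finitely supported with zero
operator rows on `dist · c₀ ≤ ρ_f`, `1 ≤ R`, `2R+2 ≤ ρ_f`, `τ ∈ Λ₀` with `‖Aτ‖ ≤ 2` and domination constant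
`M_τ`, and `0 < Y ≤ 2R+2`: `κ Σ_{x∈F} ‖f x − f(x + Aτ)‖² ≤ M_τ [ (Cₐ/R²) M(f; 4R+4) + Cⱼ J_Y(f) ]`. [folklore] -/
theorem diff_sum_le (hA : Adm₀ A) (hI : Inner₀ t A) (hκ0 : 0 ≤ κ)
    (hκ : ∀ v : (EuclideanSpace ℝ (Fin 3)) → (EuclideanSpace ℝ (Fin 3)), (Function.support v).Finite →
      Function.support v ⊆ Sites₀ t A → κ * nnForm t A v ≤ ∑' p : Sites₀ t A, ⟪𝕃 v @ p, v p⟫)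
    {f : (EuclideanSpace ℝ (Fin 3)) → (EuclideanSpace ℝ (Fin 3))} (hf : (Function.support f).Finite)
    {R : ℝ} (hR : 1 ≤ R) {ρf : ℝ} (hρf : 2 * R + 2 ≤ ρf)
    (hharm : ∀ p : Sites₀ t A, dist (p : EuclideanSpace ℝ (Fin 3)) c₀ ≤ ρf → 𝕃 f @ p = 0)
    {τ : EuclideanSpace ℝ (Fin 3)} (hτ : τ ∈ Λ₀) (hτ2 : ‖A τ‖ ≤ 2) {Mτ : ℝ} (hM : 0 ≤ Mτ)
    (hdom : ∀ v : (EuclideanSpace ℝ (Fin 3)) → (EuclideanSpace ℝ (Fin 3)), (Function.support v).Finite →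
      ∑' p : Sites₀ t A, ‖v p - v ((p : (EuclideanSpace ℝ (Fin 3))) + A τ)‖ ^ 2 ≤ Mτ * nnForm t A v)
    {Y : ℝ} (hY : 0 < Y) (hYR : Y ≤ 2 * R + 2)
    (F : Finset (EuclideanSpace ℝ (Fin 3))) (hF : ∀ x ∈ F, x ∈ Sites₀ t A ∧ dist x c₀ ≤ R) :
    κ * ∑ x ∈ F, ‖f x - f (x + A τ)‖ ^ 2 ≤ Mτ * (Cₐ / R ^ 2 * 𝐌[f, 4 * R + 4] + Cⱼ * 𝐉[f, Y]) := by
  have hR0 : 0 < R := by linarith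
  have key := level_estimate hA hI hκ0 hκ hf hR hρf hharm hτ hτ2 hM hdom (μ := R ^ 3) (by positivity) F hF
  exact key.trans (mul_le_mul_of_nonneg_left (level_rhs_le hA hI hf hR hY hYR) hM)

/-- **One level in mass form**: `κ M(Δ_τ f; R) ≤ M_τ [ (Cₐ/R²) M(f; 4R+4) + Cⱼ J_Y(f) ]`. [folklore] -/
theorem mass_diff_le (hA : Adm₀ A) (hI : Inner₀ t A) (hκ0 : 0 ≤ κ)
    (hκ : ∀ v : (EuclideanSpace ℝ (Fin 3)) → (EuclideanSpace ℝ (Fin 3)), (Function.support v).Finite →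
      Function.support v ⊆ Sites₀ t A → κ * nnForm t A v ≤ ∑' p : Sites₀ t A, ⟪𝕃 v @ p, v p⟫)
    {f : (EuclideanSpace ℝ (Fin 3)) → (EuclideanSpace ℝ (Fin 3))} (hf : (Function.support f).Finite)
    {R : ℝ} (hR : 1 ≤ R) {ρf : ℝ} (hρf : 2 * R + 2 ≤ ρf)
    (hharm : ∀ p : Sites₀ t A, dist (p : EuclideanSpace ℝ (Fin 3)) c₀ ≤ ρf → 𝕃 f @ p = 0)
    {τ : EuclideanSpace ℝ (Fin 3)} (hτ : τ ∈ Λ₀) (hτ2 : ‖A τ‖ ≤ 2) {Mτ : ℝ} (hM : 0 ≤ Mτ)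
    (hdom : ∀ v : (EuclideanSpace ℝ (Fin 3)) → (EuclideanSpace ℝ (Fin 3)), (Function.support v).Finite →
      ∑' p : Sites₀ t A, ‖v p - v ((p : (EuclideanSpace ℝ (Fin 3))) + A τ)‖ ^ 2 ≤ Mτ * nnForm t A v)
    {Y : ℝ} (hY : 0 < Y) (hYR : Y ≤ 2 * R + 2) :
    κ * 𝐌[Δ[τ] f, R] ≤ Mτ * (Cₐ / R ^ 2 * 𝐌[f, 4 * R + 4] + Cⱼ * 𝐉[f, Y]) := by
  have h1 : 𝐌[Δ[τ] f, R] = ∑ x ∈ (finite_sites_dist_le hA hI c₀ R).toFinset, ‖f x - f (x + A τ)‖ ^ 2 := by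
    rw [tsum_indicator_eq_sum hA hI (fun x => ‖f (x + A τ) - f x‖ ^ 2) c₀ R]
    exact Finset.sum_congr rfl fun x _ => by rw [norm_sub_rev]
  rw [h1]
  exact diff_sum_le hA hI hκ0 hκ hf hR hρf hharm hτ hτ2 hM hdom hY hYR (finite_sites_dist_le hA hI c₀ R).toFinset
    (fun x hx => (Set.Finite.mem_toFinset (finite_sites_dist_le hA hI c₀ R)).1 hx)

/-- **One level in mass form, with work term** (level `1`): for `f` finitely supported with operator rows
`Gf` on `dist · c₀ ≤ ρ_f`, `1 ≤ R`, `2R+2 ≤ ρ_f`, `τ ∈ Λ₀` with `‖Aτ‖ ≤ 2` and domination constant `M_τ`, and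
`0 < Y ≤ 2R+2`: `κ M(Δ_τ f; R) ≤ M_τ [ Σ' η² ⟪Gf, f⟫ + (Cₐ/R²) M(f; 4R+4) + Cⱼ J_Y(f) ]` with the radial site
cutoff `η` at radii `R+2`, `2R+2`. [folklore] -/
theorem mass_diff_le_work (hA : Adm₀ A) (hI : Inner₀ t A) (hκ0 : 0 ≤ κ)
    (hκ : ∀ v : (EuclideanSpace ℝ (Fin 3)) → (EuclideanSpace ℝ (Fin 3)), (Function.support v).Finite →
      Function.support v ⊆ Sites₀ t A → κ * nnForm t A v ≤ ∑' p : Sites₀ t A, ⟪𝕃 v @ p, v p⟫)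
    {f : (EuclideanSpace ℝ (Fin 3)) → (EuclideanSpace ℝ (Fin 3))} (hf : (Function.support f).Finite)
    {R : ℝ} (hR : 1 ≤ R) {ρf : ℝ} (hρf : 2 * R + 2 ≤ ρf)
    {Gf : (EuclideanSpace ℝ (Fin 3)) → (EuclideanSpace ℝ (Fin 3))}
    (hrows : ∀ p : Sites₀ t A, dist (p : EuclideanSpace ℝ (Fin 3)) c₀ ≤ ρf → 𝕃 f @ p = Gf p)
    {τ : EuclideanSpace ℝ (Fin 3)} (hτ : τ ∈ Λ₀) (hτ2 : ‖A τ‖ ≤ 2) {Mτ : ℝ} (hM : 0 ≤ Mτ)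
    (hdom : ∀ v : (EuclideanSpace ℝ (Fin 3)) → (EuclideanSpace ℝ (Fin 3)), (Function.support v).Finite →
      ∑' p : Sites₀ t A, ‖v p - v ((p : (EuclideanSpace ℝ (Fin 3))) + A τ)‖ ^ 2 ≤ Mτ * nnForm t A v)
    {Y : ℝ} (hY : 0 < Y) (hYR : Y ≤ 2 * R + 2) :
    κ * 𝐌[Δ[τ] f, R] ≤ Mτ * ((∑' p : Sites₀ t A, (if (p : EuclideanSpace ℝ (Fin 3)) ∈ Sites₀ t A then
          max (min 1 ((R + 2 + R - dist (p : EuclideanSpace ℝ (Fin 3)) c₀) / R)) 0 else 0) ^ 2 * ⟪Gf p, f p⟫) +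
      (Cₐ / R ^ 2 * 𝐌[f, 4 * R + 4] + Cⱼ * 𝐉[f, Y])) := by
  have hR0 : 0 < R := by linarith
  have h1 : 𝐌[Δ[τ] f, R] = ∑ x ∈ (finite_sites_dist_le hA hI c₀ R).toFinset, ‖f x - f (x + A τ)‖ ^ 2 := by
    rw [tsum_indicator_eq_sum hA hI (fun x => ‖f (x + A τ) - f x‖ ^ 2) c₀ R]
    exact Finset.sum_congr rfl fun x _ => by rw [norm_sub_rev]
  rw [h1]
  have key := level_estimate_work hA hI hκ0 hκ hf hR hρf hrows hτ hτ2 hM hdom (μ := R ^ 3) (by positivity)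
    (finite_sites_dist_le hA hI c₀ R).toFinset
    (fun x hx => (Set.Finite.mem_toFinset (finite_sites_dist_le hA hI c₀ R)).1 hx)
  refine key.trans (mul_le_mul_of_nonneg_left ?_ hM)
  have h2 := level_rhs_le (c₀ := c₀) hA hI hf hR hY hYR
  linarith

/-- **One level in mass form for the cross-sublattice difference**, on a finite set `F` of sublattice-`0` sites
in `B_R(c₀)`: `κ Σ_{x∈F} ‖f x − f(x + (t 1 − t 0))‖² ≤ (Cₐ/R²) M(f; 4R+4) + Cⱼ J_Y(f)`. [folklore] -/
theorem cross_sum_le (hA : Adm₀ A) (hI : Inner₀ t A) (hκ0 : 0 ≤ κ)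
    (hκ : ∀ v : (EuclideanSpace ℝ (Fin 3)) → (EuclideanSpace ℝ (Fin 3)), (Function.support v).Finite →
      Function.support v ⊆ Sites₀ t A → κ * nnForm t A v ≤ ∑' p : Sites₀ t A, ⟪𝕃 v @ p, v p⟫)
    {f : (EuclideanSpace ℝ (Fin 3)) → (EuclideanSpace ℝ (Fin 3))} (hf : (Function.support f).Finite)
    {R : ℝ} (hR : 1 ≤ R) {ρf : ℝ} (hρf : 2 * R + 2 ≤ ρf)
    (hharm : ∀ p : Sites₀ t A, dist (p : EuclideanSpace ℝ (Fin 3)) c₀ ≤ ρf → 𝕃 f @ p = 0)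
    {Y : ℝ} (hY : 0 < Y) (hYR : Y ≤ 2 * R + 2)
    (F : Finset (EuclideanSpace ℝ (Fin 3))) (hF : ∀ x ∈ F, (∃ z ∈ Λ₀, x = t 0 + A z) ∧ dist x c₀ ≤ R) :
    κ * ∑ x ∈ F, ‖f x - f (x + (t 1 - t 0))‖ ^ 2 ≤ Cₐ / R ^ 2 * 𝐌[f, 4 * R + 4] + Cⱼ * 𝐉[f, Y] := by
  have hR0 : 0 < R := by linarith
  have key := level_estimate_cross hA hI hκ0 hκ hf hR hρf hharm (μ := R ^ 3) (by positivity) F hF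
  exact key.trans (level_rhs_le hA hI hf hR hY hYR)

/-! ## The weighted far mass of translates and differences -/

/-- Weight comparison: `(max(dist (q − s) c₀, Y))⁻⁸ ≤ 2 (max(dist q c₀, Y))⁻⁸` for `‖s‖ ≤ 2`, `Y ≥ 25`. [folklore] -/
theorem farWeight_shift_le {q s : EuclideanSpace ℝ (Fin 3)} (hs : ‖s‖ ≤ 2) {Y : ℝ} (hY : 25 ≤ Y) :
    (max (dist (q - s) c₀) Y)⁻¹ ^ 8 ≤ 2 * (max (dist q c₀) Y)⁻¹ ^ 8 := by
  set d := dist q c₀ with hd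
  set d' := dist (q - s) c₀ with hd'
  have hdd : d ≤ d' + 2 := by
    have h1 := dist_triangle q (q - s) c₀
    have h2 : dist q (q - s) = ‖s‖ := by rw [dist_eq_norm, sub_sub_cancel]
    linarith
  set m := max d Y with hm
  set m' := max d' Y with hm'
  have hm0 : 0 < m := lt_max_of_lt_right (by linarith)
  have hm'0 : 0 < m' := lt_max_of_lt_right (by linarith)
  have hmm : (23 / 25) * m ≤ m' := by
    rcases le_or_gt d Y with hdY | hdY
    · have : m = Y := max_eq_right hdY
      rw [this]
      exact le_trans (by linarith) (le_max_right _ _)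
    · have : m = d := max_eq_left hdY.le
      rw [this]
      have : d - 2 ≤ m' := le_trans (by linarith) (le_max_left _ _)
      linarith
  have hinv : m'⁻¹ ≤ (25 / 23) * m⁻¹ := by
    rw [show (25 / 23 : ℝ) * m⁻¹ = ((23 / 25) * m)⁻¹ by rw [mul_inv]; norm_num]
    exact (inv_le_inv₀ hm'0 (by positivity)).2 hmm
  calc m'⁻¹ ^ 8 ≤ ((25 / 23) * m⁻¹) ^ 8 := pow_le_pow_left₀ (by positivity) hinv 8
    _ = (25 / 23 : ℝ) ^ 8 * m⁻¹ ^ 8 := by ring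
    _ ≤ 2 * m⁻¹ ^ 8 := by
        refine mul_le_mul_of_nonneg_right (by norm_num) (by positivity)

/-- **Far mass of a translate**: `J_Y(f(· + Aτ)) ≤ 2 J_Y(f)` for `τ ∈ Λ₀`, `‖Aτ‖ ≤ 2`, `Y ≥ 25`. [folklore] -/
theorem farMass_translate_le {f : (EuclideanSpace ℝ (Fin 3)) → (EuclideanSpace ℝ (Fin 3))}
    (hf : (Function.support f).Finite) {τ : EuclideanSpace ℝ (Fin 3)} (hτ : τ ∈ Λ₀) (hτ2 : ‖A τ‖ ≤ 2)
    {Y : ℝ} (hY : 25 ≤ Y) :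
    𝐉[(fun x => f (x + A τ)), Y] ≤ 2 * 𝐉[f, Y] := by
  have hre := tsum_sites_translate (t := t) (A := A)
    (fun x : EuclideanSpace ℝ (Fin 3) => ‖f x‖ ^ 2 * (max (dist (x - A τ) c₀) Y)⁻¹ ^ 8) hτ
  simp only [add_sub_cancel_right] at hre
  rw [hre, ← tsum_mul_left]
  have hs1 : Summable fun q : Sites₀ t A => ‖f q‖ ^ 2 * (max (dist ((q : EuclideanSpace ℝ (Fin 3)) - A τ) c₀) Y)⁻¹ ^ 8 := by
    have := summable_normSq_mul_of_finite (t := t) (A := A) hf (fun x => (max (dist (x - A τ) c₀) Y)⁻¹ ^ 8)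
    simpa only using this
  have hs2 : Summable fun q : Sites₀ t A => ‖f q‖ ^ 2 * (max (dist (q : EuclideanSpace ℝ (Fin 3)) c₀) Y)⁻¹ ^ 8 := by
    have := summable_normSq_mul_of_finite (t := t) (A := A) hf (fun x => (max (dist x c₀) Y)⁻¹ ^ 8)
    simpa only using this
  refine hs1.tsum_le_tsum (fun q => ?_) (hs2.mul_left 2)
  have h := farWeight_shift_le (c₀ := c₀) (q := (q : EuclideanSpace ℝ (Fin 3))) hτ2 hY
  have h0 : 0 ≤ ‖f q‖ ^ 2 := sq_nonneg _
  calc ‖f q‖ ^ 2 * (max (dist ((q : EuclideanSpace ℝ (Fin 3)) - A τ) c₀) Y)⁻¹ ^ 8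
      ≤ ‖f q‖ ^ 2 * (2 * (max (dist (q : EuclideanSpace ℝ (Fin 3)) c₀) Y)⁻¹ ^ 8) := mul_le_mul_of_nonneg_left h h0
    _ = 2 * (‖f q‖ ^ 2 * (max (dist (q : EuclideanSpace ℝ (Fin 3)) c₀) Y)⁻¹ ^ 8) := by ring

/-- **Far mass of a difference**: `J_Y(Δ_τ f) ≤ 6 J_Y(f)` for `τ ∈ Λ₀`, `‖Aτ‖ ≤ 2`, `Y ≥ 25`. [folklore] -/
theorem farMass_diff_le {f : (EuclideanSpace ℝ (Fin 3)) → (EuclideanSpace ℝ (Fin 3))}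
    (hf : (Function.support f).Finite) {τ : EuclideanSpace ℝ (Fin 3)} (hτ : τ ∈ Λ₀) (hτ2 : ‖A τ‖ ≤ 2)
    {Y : ℝ} (hY : 25 ≤ Y) :
    𝐉[Δ[τ] f, Y] ≤ 6 * 𝐉[f, Y] := by
  have hT := farMass_translate_le (t := t) (A := A) (c₀ := c₀) hf hτ hτ2 hY
  set w : (EuclideanSpace ℝ (Fin 3)) → ℝ := fun x => (max (dist x c₀) Y)⁻¹ ^ 8 with hw
  have hw0 : ∀ x, 0 ≤ w x := fun x => by
    have : 0 < max (dist x c₀) Y := lt_max_of_lt_right (by linarith)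
    positivity
  have hs0 : Summable fun q : Sites₀ t A => ‖f q‖ ^ 2 * w q := by
    have := summable_normSq_mul_of_finite (t := t) (A := A) hf w
    simpa only using this
  have hsT : Summable fun q : Sites₀ t A => ‖f ((q : EuclideanSpace ℝ (Fin 3)) + A τ)‖ ^ 2 * w q := by
    have := summable_normSq_mul_of_finite (t := t) (A := A) (finite_support_translate hf (A τ)) w
    simpa only using this
  have hsD : Summable fun q : Sites₀ t A => ‖f ((q : EuclideanSpace ℝ (Fin 3)) + A τ) - f q‖ ^ 2 * w q := by
    have := summable_normSq_mul_of_finite (t := t) (A := A) (finite_support_translate_sub hf (A τ)) w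
    simpa only using this
  have hpt : ∀ q : Sites₀ t A, ‖f ((q : EuclideanSpace ℝ (Fin 3)) + A τ) - f q‖ ^ 2 * w q ≤
      2 * (‖f ((q : EuclideanSpace ℝ (Fin 3)) + A τ)‖ ^ 2 * w q) + 2 * (‖f q‖ ^ 2 * w q) := by
    intro q
    set a := ‖f ((q : EuclideanSpace ℝ (Fin 3)) + A τ)‖ with ha
    set b := ‖f q‖ with hb
    have h : ‖f ((q : EuclideanSpace ℝ (Fin 3)) + A τ) - f q‖ ≤ a + b := norm_sub_le _ _
    have h2 : ‖f ((q : EuclideanSpace ℝ (Fin 3)) + A τ) - f q‖ ^ 2 ≤ (a + b) ^ 2 := pow_le_pow_left₀ (norm_nonneg _) h 2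
    have h3 : (a + b) ^ 2 ≤ 2 * a ^ 2 + 2 * b ^ 2 := by nlinarith [sq_nonneg (a - b)]
    have hwq := hw0 q
    calc ‖f ((q : EuclideanSpace ℝ (Fin 3)) + A τ) - f q‖ ^ 2 * w q ≤ (2 * a ^ 2 + 2 * b ^ 2) * w q :=
          mul_le_mul_of_nonneg_right (h2.trans h3) hwq
      _ = 2 * (a ^ 2 * w q) + 2 * (b ^ 2 * w q) := by ring
  calc 𝐉[Δ[τ] f, Y] ≤ ∑' q : Sites₀ t A, (2 * (‖f ((q : EuclideanSpace ℝ (Fin 3)) + A τ)‖ ^ 2 * w q) + 2 * (‖f q‖ ^ 2 * w q)) :=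
        hsD.tsum_le_tsum hpt ((hsT.mul_left 2).add (hs0.mul_left 2))
    _ = 2 * 𝐉[(fun x => f (x + A τ)), Y] + 2 * 𝐉[f, Y] := by
        rw [(hsT.mul_left 2).tsum_add (hs0.mul_left 2), tsum_mul_left, tsum_mul_left]
    _ ≤ 2 * (2 * 𝐉[f, Y]) + 2 * 𝐉[f, Y] := by linarith
    _ = 6 * 𝐉[f, Y] := by ring

end

end Summit.AtomisticToContinuum.Crystallization.Theorems.ExcessDecayLiouville

end
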